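import Summits.ResolutionOfSingularities.ResolutionOfSingularities.Theorems.FrobeniusLadderFRationalResolutionConeCertificateFreeChart
import Summits.ResolutionOfSingularities.ResolutionOfSingularities.Theorems.FrobeniusLadderFRationalResolutionBlowupOrbitCentre
import Literature.AlgebraicGeometry.Resolution.AffineBlowupReductionCover
import HarnessLib

/-!
# Crux `FrobeniusLadder.FRationalResolution` (stmt-ResolutionOfSingularities-15317), line `redirect`,
# stub `stub_diagonalizableQuotientResolution` — VERTEX CERTIFICATES FROM REGULAR VERTEX CHARTS
# (the vertex slot of a singular vertex chart whose OWN point blow-up is regular, e.g. the `A₂` cone; item (β-cert-2) of MEMO-g26 §4)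

The second disjunct of a vertex chart in `…ConeCertificateFreeChart.hasResolution_of_isolated_fixedPoints_of_mixedConeCertificate`
(p843969) asks for the vertex certificate `Scheme.IsRegular (affineBlowup 𝔳)` of the monomial algebra `K[χᵍ : g ∈ G_Q] ⊆ K[x]` of the
chart cone. For Veronese cones this is `veroneseCone_isRegular_affineBlowup`; this file proves it for EVERY cone all of whose own vertex
charts are regular (free), from cone data — by the reduction-cover criterion
`Literature.….affineBlowup.isRegular_of_isRegularRing_blowupAlgebra_of_pow_le` and transport to the sub-algebra presentation:

* ★ `isRegularRing_blowupAlgebra_of_regular_cone` — `κ[P][J/χ^{e₀}] ≅ κ[Q]` is a regular ring when `κ[Q]` is;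
* ★★ `isRegular_affineBlowup_vertexIdeal_of_regular_cones` — `Bl_𝔳 Spec κ[P]` is regular when every vertex chart has regular cone data
  (monoid-algebra presentation);
* ★★★ `vertexCertificate_of_regular_cones` — the same in the presentation `K[χᵍ : g ∈ G] ⊆ K[x₁,…,xₙ]` of the certificate's vertex slot.

Honest label: combinatorial/algebraic helper toward ONE leaf stub (no stub, crux or summit closed). No definitions, no named facts, no
sorry. [folklore; cite: CoxLittleSchenck2011, §3.3] [cite: GortzWedhorn2020, (13.19) p. 415]
-/

noncomputable section

-- single-problem summit: the doubled namespace component is forced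
set_option linter.dupNamespace false

open CategoryTheory AlgebraicGeometry TopologicalSpace IsLocalRing
open Literature.AlgebraicGeometry.Resolution

namespace Summit.ResolutionOfSingularities.ResolutionOfSingularities.Theorems.FRationalResolution.MonoidAlgebraLaurent

variable (κ : Type) [Field κ] {n : ℕ} (P : AddSubmonoid (Fin n →₀ ℕ))

/-- The exponent of `p ∈ ℕⁿ` in `ℤⁿ`. -/
local notation3 (prettyPrint := false) "toZ[" n "]" =>
  (Finsupp.mapRange.addMonoidHom (Nat.castAddMonoidHom ℤ) : (Fin n →₀ ℕ) →+ (Fin n →₀ ℤ))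

/-- The vertex ideal of the monoid algebra `κ[P]`. -/
local notation3 (prettyPrint := false) "𝕍[" κ ", " P "]" =>
  Ideal.span ((fun p : ↥P => AddMonoidAlgebra.single p (1 : κ)) '' {p : ↥P | p ≠ 0})

/-- The monomial sub-algebra `κ[χᵈ : d ∈ G] ⊆ κ[x₁,…,xₙ]`. -/
local notation3 (prettyPrint := false) "𝕋[" κ ", " G "]" =>
  Algebra.adjoin κ ((fun d : Fin n →₀ ℕ => MvPolynomial.monomial d (1 : κ)) '' G)

/-- Its vertex ideal. -/
local notation3 (prettyPrint := false) "𝕍𝕋[" κ ", " G "]" =>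
  Ideal.span {v : ↥𝕋[κ, G] | ∃ d ∈ G, (v : MvPolynomial (Fin n) κ) = MvPolynomial.monomial d 1}

/-! ## §1 A regular chart ring -/

/-- ★ **`κ[P][J/χ^{e₀}]` is a regular ring when its cone monoid algebra `κ[Q]` is.** [folklore; cite: CoxLittleSchenck2011, §1.1] -/
theorem isRegularRing_blowupAlgebra_of_regular_cone (e₀ : ↥P) (E : Set ↥P)
    {n' : ℕ} (Q : AddSubmonoid (Fin n' →₀ ℕ)) (ι : ↥Q →+ (Fin n →₀ ℤ)) (hι : Function.Injective ι)
    (hE : ∀ e ∈ E, ∃ q : ↥Q, ι q = toZ[n] (e : Fin n →₀ ℕ) - toZ[n] (e₀ : Fin n →₀ ℕ))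
    (hP : ∀ p : ↥P, ∃ q : ↥Q, ι q = toZ[n] (p : Fin n →₀ ℕ))
    (hQ : ∀ q : ↥Q, ∃ (p : ↥P) (m : ℕ) (e : Fin m → ↥P), (∀ i, e i ∈ E) ∧
      ι q = toZ[n] (p : Fin n →₀ ℕ) + ∑ i, (toZ[n] ((e i : ↥P) : Fin n →₀ ℕ) - toZ[n] (e₀ : Fin n →₀ ℕ)))
    (hreg : IsRegularRing (AddMonoidAlgebra κ ↥Q)) :
    IsRegularRing ↥(blowupAlgebra (Ideal.span ((fun e : ↥P => AddMonoidAlgebra.single e (1 : κ)) '' E))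
      (AddMonoidAlgebra.single e₀ (1 : κ))) := by
  classical
  obtain ⟨Φ, hΦinj, hΦrange, -⟩ := exists_algHom_chart κ P e₀ E Q ι hι hE hP hQ
  have hΦmem : ∀ x, Φ x ∈ blowupAlgebra (Ideal.span ((fun e : ↥P => AddMonoidAlgebra.single e (1 : κ)) '' E))
      (AddMonoidAlgebra.single e₀ (1 : κ)) := fun x => by
    have : Φ x ∈ Set.range Φ := ⟨x, rfl⟩
    rw [hΦrange] at this
    exact this
  let f : AddMonoidAlgebra κ ↥Q →+* ↥(blowupAlgebra (Ideal.span ((fun e : ↥P => AddMonoidAlgebra.single e (1 : κ)) '' E))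
      (AddMonoidAlgebra.single e₀ (1 : κ))) :=
    Φ.toRingHom.codRestrict (blowupAlgebra (Ideal.span ((fun e : ↥P => AddMonoidAlgebra.single e (1 : κ)) '' E))
      (AddMonoidAlgebra.single e₀ (1 : κ))) hΦmem
  have hf : ∀ x, ((f x : ↥(blowupAlgebra (Ideal.span ((fun e : ↥P => AddMonoidAlgebra.single e (1 : κ)) '' E))
      (AddMonoidAlgebra.single e₀ (1 : κ)))) : Localization.Away (AddMonoidAlgebra.single e₀ (1 : κ))) = Φ x := fun _ => rfl
  have hfbij : Function.Bijective f := by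
    constructor
    · intro a b hab
      exact hΦinj (by rw [← hf, ← hf, hab])
    · intro z
      have hz : (z : Localization.Away (AddMonoidAlgebra.single e₀ (1 : κ))) ∈ Set.range Φ := by rw [hΦrange]; exact z.2
      obtain ⟨x, hx⟩ := hz
      exact ⟨x, Subtype.ext (by rw [hf, hx])⟩
  exact IsRegularRing.of_ringEquiv (RingEquiv.ofBijective f hfbij)

/-! ## §2 The point blow-up of `κ[P]` from regular vertex charts -/

/-- ★★ **`Bl_𝔳 Spec κ[P]` IS REGULAR WHEN EVERY VERTEX CHART HAS REGULAR CONE DATA** (monoid-algebra presentation). Data as in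
`…ConeCertificateFreeChart.modelCertificate_of_mixedCone` with the first disjunct at every vertex. [folklore; cite: CoxLittleSchenck2011, §3.3]
[cite: GortzWedhorn2020, (13.19) p. 415] -/
theorem isRegular_affineBlowup_vertexIdeal_of_regular_cones
    (G : Set (Fin n →₀ ℕ)) (hG0 : (0 : Fin n →₀ ℕ) ∉ G) (hGP : AddSubmonoid.closure G = P)
    {N : ℕ} (gen : Fin N → ↥P) (hgenG : ∀ i, ((gen i : ↥P) : Fin n →₀ ℕ) ∈ G) (hGgen : ∀ g ∈ G, ∃ i, ((gen i : ↥P) : Fin n →₀ ℕ) = g)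
    {m : ℕ} (v : Fin m → ↥P) (hv0 : ∀ j, v j ≠ 0)
    (kk : ℕ) (hkk : 1 ≤ kk) (c : Fin N → Fin m) (jj : Fin N → ℕ) (hjj : ∀ i, jj i + 1 ≤ kk)
    (q : ∀ i, Fin (jj i) → ↥P) (hq0 : ∀ i l, q i l ≠ 0) (hid : ∀ i, (jj i + 1) • gen i = v (c i) + ∑ l, q i l)
    (hcone : ∀ j : Fin m, ∃ (n' : ℕ) (Q : AddSubmonoid (Fin n' →₀ ℕ)) (ι : ↥Q →+ (Fin n →₀ ℤ)) (_ : Function.Injective ι)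
      (_ : ∀ e : ↥P, e ≠ 0 → ∃ u : ↥Q, ι u = toZ[n] (e : Fin n →₀ ℕ) - toZ[n] ((v j : ↥P) : Fin n →₀ ℕ))
      (_ : ∀ p : ↥P, ∃ u : ↥Q, ι u = toZ[n] (p : Fin n →₀ ℕ))
      (_ : ∀ u : ↥Q, ∃ (p : ↥P) (r : ℕ) (e : Fin r → ↥P), (∀ i, e i ≠ 0) ∧
        ι u = toZ[n] (p : Fin n →₀ ℕ) + ∑ i, (toZ[n] ((e i : ↥P) : Fin n →₀ ℕ) - toZ[n] ((v j : ↥P) : Fin n →₀ ℕ))),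
      IsRegularRing (AddMonoidAlgebra κ ↥Q)) :
    Scheme.IsRegular (affineBlowup 𝕍[κ, P]) := by
  have hgen0 : ∀ i, gen i ≠ 0 := fun i h => hG0 (by simpa [h] using hgenG i)
  have hxv : 𝕍[κ, P] = Ideal.span (Set.range fun i => AddMonoidAlgebra.single (gen i) (1 : κ)) := by
    rw [MonoidAlgebraModel.vertexIdeal_eq_span_image κ P G hG0 hGP]
    congr 1
    ext z
    constructor
    · rintro ⟨p, hp, rfl⟩
      obtain ⟨i, hi⟩ := hGgen _ hp
      exact ⟨i, by change AddMonoidAlgebra.single (gen i) (1 : κ) = AddMonoidAlgebra.single p 1; rw [Subtype.ext hi]⟩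
    · rintro ⟨i, rfl⟩
      exact ⟨gen i, hgenG i, rfl⟩
  have hyJ : ∀ j, AddMonoidAlgebra.single (v j) (1 : κ) ∈ 𝕍[κ, P] := fun j =>
    MonoidAlgebraModel.single_mem_vertexIdeal κ P (v j) (hv0 j)
  have hred : 𝕍[κ, P] ^ (N * (kk - 1) + 1) ≤
      Ideal.span (Set.range fun j => AddMonoidAlgebra.single (v j) (1 : κ)) * 𝕍[κ, P] ^ (N * (kk - 1)) :=
    MonoidAlgebraModel.vertexIdeal_pow_le_of_nsmul_eq κ P (fun i => AddMonoidAlgebra.single (gen i) 1) gen hgen0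
      (fun _ => rfl) hxv (Ideal.span (Set.range fun j => AddMonoidAlgebra.single (v j) (1 : κ)))
      (fun i => v (c i)) (fun i => Ideal.subset_span ⟨c i, rfl⟩) kk hkk jj hjj q hq0 hid
  refine affineBlowup.isRegular_of_isRegularRing_blowupAlgebra_of_pow_le (I := 𝕍[κ, P])
    (fun j => AddMonoidAlgebra.single (v j) (1 : κ)) hyJ hred fun j => ?_
  have hj := hcone j
  obtain ⟨n', Q, ι, hι, hE, hPQ, hQ, hreg⟩ := hj
  exact isRegularRing_blowupAlgebra_of_regular_cone κ P (v j) {p : ↥P | p ≠ 0} Q ι hι (fun e he => hE e he) hPQ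
    (fun u => by obtain ⟨p, r, e, he, hu⟩ := hQ u; exact ⟨p, r, e, he, hu⟩) hreg

/-! ## §3 Transport to the sub-algebra presentation -/

/-- ★★★ **THE VERTEX CERTIFICATE OF A CONE WITH REGULAR VERTEX CHARTS**, in the presentation `K[χᵍ : g ∈ G] ⊆ K[x₁,…,xₙ]` used by the
vertex slot of the class certificates: the point blow-up of the monomial algebra of `G` is a regular scheme, for the field `K`, given
regular cone data at every vertex (as in `isRegular_affineBlowup_vertexIdeal_of_regular_cones`). [folklore; cite: CoxLittleSchenck2011, §3.3] -/
theorem vertexCertificate_of_regular_cones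
    (G : Set (Fin n →₀ ℕ)) (hG0 : (0 : Fin n →₀ ℕ) ∉ G) (hGP : AddSubmonoid.closure G = P)
    {N : ℕ} (gen : Fin N → ↥P) (hgenG : ∀ i, ((gen i : ↥P) : Fin n →₀ ℕ) ∈ G) (hGgen : ∀ g ∈ G, ∃ i, ((gen i : ↥P) : Fin n →₀ ℕ) = g)
    {m : ℕ} (v : Fin m → ↥P) (hv0 : ∀ j, v j ≠ 0)
    (kk : ℕ) (hkk : 1 ≤ kk) (c : Fin N → Fin m) (jj : Fin N → ℕ) (hjj : ∀ i, jj i + 1 ≤ kk)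
    (q : ∀ i, Fin (jj i) → ↥P) (hq0 : ∀ i l, q i l ≠ 0) (hid : ∀ i, (jj i + 1) • gen i = v (c i) + ∑ l, q i l)
    (hcone : ∀ j : Fin m, ∃ (n' : ℕ) (Q : AddSubmonoid (Fin n' →₀ ℕ)) (ι : ↥Q →+ (Fin n →₀ ℤ)) (_ : Function.Injective ι)
      (_ : ∀ e : ↥P, e ≠ 0 → ∃ u : ↥Q, ι u = toZ[n] (e : Fin n →₀ ℕ) - toZ[n] ((v j : ↥P) : Fin n →₀ ℕ))
      (_ : ∀ p : ↥P, ∃ u : ↥Q, ι u = toZ[n] (p : Fin n →₀ ℕ))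
      (_ : ∀ u : ↥Q, ∃ (p : ↥P) (r : ℕ) (e : Fin r → ↥P), (∀ i, e i ≠ 0) ∧
        ι u = toZ[n] (p : Fin n →₀ ℕ) + ∑ i, (toZ[n] ((e i : ↥P) : Fin n →₀ ℕ) - toZ[n] ((v j : ↥P) : Fin n →₀ ℕ))),
      IsRegularRing (AddMonoidAlgebra κ ↥Q)) :
    Scheme.IsRegular (affineBlowup 𝕍𝕋[κ, G]) := by
  have hreg := isRegular_affineBlowup_vertexIdeal_of_regular_cones κ P G hG0 hGP gen hgenG hGgen v hv0 kk hkk c jj hjj q hq0 hid hcone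
  obtain ⟨e, he⟩ := MonomialAlgebraDimension.algEquiv_addMonoidAlgebra κ G P hGP
  have hiff := MonoidAlgebraModel.mem_vertexIdeal_iff_of_algEquiv κ P G hG0 hGP e he
  -- `𝔳_𝕋 = e(𝔳_P)`
  have hmap : (𝕍[κ, P]).map (e.toRingEquiv : AddMonoidAlgebra κ ↥P →+* ↥𝕋[κ, G]) = 𝕍𝕋[κ, G] := by
    have hcomap : (𝕍𝕋[κ, G]).comap (e.toRingEquiv : AddMonoidAlgebra κ ↥P →+* ↥𝕋[κ, G]) = 𝕍[κ, P] := by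
      ext s
      rw [Ideal.mem_comap]
      change e s ∈ 𝕍𝕋[κ, G] ↔ _
      rw [hiff, AlgEquiv.symm_apply_apply]
    rw [← hcomap]
    exact Ideal.map_comap_of_surjective _ e.surjective _
  have := BlowupOrbitCentre.isRegular_affineBlowup_map_of_ringEquiv e.toRingEquiv 𝕍[κ, P] hreg
  rw [hmap] at this
  exact this

end Summit.ResolutionOfSingularities.ResolutionOfSingularities.Theorems.FRationalResolution.MonoidAlgebraLaurent

end
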